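import Summits.BirchSwinnertonDyer.Rank1Residual.X2.CongruentLambdaShiftDerived
import Summits.BirchSwinnertonDyer.Rank1Residual.X2.EulerFactorInvariants
import Literature.NumberTheory.DiophantineGeometry.LocalReductionFiniteBadPlacesProofs
import HarnessLib
import HarnessLib.Audit

/-!
# desc-C9 — THE DIRECTION LAW OF VISIBILITY, PROVED modulo Greenberg–Vatsal's three printed statements:
# along an Euler-factor DEGENERATION `W ↦ W'` of congruent good ordinary curves the algebraic
# `λ`-invariant can only GROW (`λ(X(W)) ≤ λ(X(W'))` at `μ = 0`) — theorems only, nothing asserted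

HONEST FRAMING (cell `bsd-f3-mu`, D-0131 (3) FRONTIER TIER, HOME `run/shared/lean/pub/bsd-f3-mu/`).
TYPER's filing (OPTIONAL TURNKEY T15 of MEMO-desc §15) of the `-desc` lens's generation-7 item desc-C9
`DegenerationLambdaMonotone` (CANDIDATES.md row 36; `HOME/desc/Sketch9.lean` sha16 af1b49c6c0edaf04 §1–§3,
rc 0, 0 sorry) — graded by the planner AND by refuter `-ref1` (fifth pass 2026-08-27T20:48:10Z, probe
`ref1/g5/DescProbe9.lean` 4809cb15952f1ec5, BC7 3/3 CLEAN) as **BARRIER-GRADE NEGATIVE KNOWLEDGE — a corollary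
of print (Greenberg–Vatsal 2000 §2 (7) + Prop. 2.8), not a crux**; refuter `-ref2` ninth pass: «known /
new-combination (barrier knowledge)», beyond-print NO.  Accordingly it is NOT filed as a conjecture node
and NOT as a named fact: this file PROVES it, as a theorem schema with explicit binders, CONDITIONAL on
exactly the three PRINTED Greenberg–Vatsal statements that are already Literature named facts (hypotheses
`hGV`, `hA`, `hB` BY NAME — the same three the kernel identity
`X2.CongruentLambdaShiftDerived.lambda_add_sum_delta_eq_of_torsionIso` is conditional on):

* `GreenbergVatsal2000.imKummer_ge_greenbergCondition_at_p` (GV p. 26 ← Greenberg LNM 1716 Props. 2.2/2.4),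
* `GreenbergVatsal2000.lambda_nonPrimitive_eq_add_sum_delta` (GV (7): `λ_{E,Σ₀} = λ_E + Σ δ`),
* `GreenbergVatsal2000.divisible_nonPrimitiveSelmerInfty_of_mu_eq_zero` (GV Prop. (2.5) / proof of (2.8)).

No new named fact; credits nothing; sorry-free.

THE ARGUMENT (MEMO-desc §15.1, three lines).  For `W, W'` globally minimal over `ℚ`, `p` odd, good ORDINARY
for both, `W[p] ≃ W'[p]` (`X1.CongruenceTransfer.TorsionIso`), cyclotomic data `(κ, γ)` and finitely
generated `Λ`-torsion dual Selmer data `D, D'` with `μ = 0`, the kernel identity gives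
`λ(D.X) + Σ_{v ∈ Σ₀} δ_W^{(v)} = λ(D'.X) + Σ_{v ∈ Σ₀} δ_{W'}^{(v)}` for `Σ₀ :=` (bad places of `W` or of
`W'`) not above `p` (finite: `WeierstrassCurve.finite_badPlaces_holds`, Silverman VIII.1.3); and if `W'` is a
DEGENERATION of `W` at every `v ∤ p` — `P̃_v(W') ∣ P̃_v(W)` in `𝔽_p[X]` (the planner's `IsEulerDegenerationAt`, spelled inline here: level
RAISING from good reduction, degeneration to additive reduction; NOT level lowering, NOT the sign flip
`1 − X ↦ 1 + X` at a common multiplicative `ℓ ≡ −1 (mod p)`) — then termwise `δ_{W'}^{(v)} ≤ δ_W^{(v)}`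
(`delta_le_of_degeneration`: root multiplicities are monotone under divisibility), hence
`λ(D.X) ≤ λ(D'.X)`.  READING (MEMO-desc §15.0 (A)–(B)): a `μ`-certifying congruent partner with TRIVIAL
value (`λ = 0`) of a pair with `λ ≥ 1` is NEVER a level-raising of it — certification flows only DOWN the
degeneration poset of `H(ρ̄)`, so «does a partner exist for Cartan-normaliser image» is a FINITE check at
the tame level `N(ρ̄)` (`lambdaInvariant_eq_zero_of_eulerDegeneration`, `not_eulerDegeneration_of_lambda_pos`).

BC5 WITNESS / FALSIFIER (MEMO-desc §15.1 F15, `HOME/desc/d15/falsifier_c9.out` a2fdcf7f9544dca0, on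
PARTNERS-DETAIL-v1 (j283830) × X9-MU-TABLE-v1 361f587418fce70d): F15a — 104 (λ_an ≥ 1 X9 row,
trivial-value partner) pairs, degeneration violations 0; F15b — 307 in-table degeneration pairs, violations
0, strict increases 71; F15c — directions of the 104: LOWER 44 / SAME LEVEL with a flip prime 22 /
INCOMPARABLE 38 / RAISE 0; the conductor-only form is REFUTED by 608e1 (λ = 1) / 608b1 (λ = 0) at `p = 5`
(sign flip at `19 ≡ −1 (mod 5)`) — the `ℓ ≡ −1` clause is necessary, which is why the law is stated for
Euler-factor divisibility and not for conductor divisibility.  NOT FILED here (out of reach of the tree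
today): desc-C9a `RaisingIsDegeneration` (theorem-grade on paper — congruent + good at `v` ⟹ degeneration
at `v` — but the tree has no `eulerFactorModP`-under-`TorsionIso` lemma) and the analytic twin desc-C9an
(needs Emerton–Pollack–Weston 2006 Thm. 5.1.x's `λ`-formula, not in the tree).
PARTITION currency: X9 790 = 130 (5Ns) + 36 (7Ns) + 624 (5S4) (+58 `r ≥ 2`); beyond-print theorem: no.

References: [GreenbergVatsal2000] §1 (5)–(7) pp. 7–8, Thm. (1.4), §2 Cor. (2.3), Prop. (2.4), (2.5),
(2.8), pp. 26–27; [GreenbergLNM1716] Props. 2.2/2.4; [SilvermanAEC2009] VIII.1 Rem. 1.3;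
[EmertonPollackWeston2006] Thm. 2, §5.1 (the analytic twin, not typed); HOME MEMO-desc.md §15,
desc/Sketch9.lean, desc/d15/falsifier_c9.out, REF1-AUDIT.md (g5 DescProbe9), CANDIDATES.md §1 row 36.
-/

-- the summit and its single problem are both named `BirchSwinnertonDyer` (registry layout D-0017)
set_option linter.dupNamespace false

noncomputable section

open scoped Classical

open NumberField IsDedekindDomain Field WeierstrassCurve
  Literature.NumberTheory.GaloisRepresentations
  Literature.NumberTheory.EllipticCurves Literature.NumberTheory.EllipticCurves.GreenbergVatsal2000
  Summit.BirchSwinnertonDyer.Rank1Residual.X1.CongruenceTransfer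
  Summit.BirchSwinnertonDyer.Rank1Residual.X2.EulerFactorInvariants
  Summit.BirchSwinnertonDyer.Rank1Residual.X2.CongruentLambdaShiftDerived

namespace Summit.BirchSwinnertonDyer.Rank1Residual.SmallImageMu

/-! ## §1 Degeneration at a place and the local law `δ_{W'}^{(v)} ≤ δ_W^{(v)}` -/

section Local

/-! «`W'` is an (Euler-factor) DEGENERATION of `W` at the finite place `v` (mod `p`)» is spelled INLINE as
`eulerFactorModP W' p v ∣ eulerFactorModP W p v` (the reduced Euler factor of `W'` divides that of `W` in
`𝔽_p[X]`; `GreenbergVatsal2000.eulerFactorModP` = Mathlib's `localPolynomialAt` reduced mod `p`) — the body of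
the planner's `Desc7.IsEulerDegenerationAt W W' p v` (`HOME/desc/Sketch9.lean` §1), so that this file declares
NO definition (theorems only).  Level raising from good reduction (degree `2 ↦ 1` or `0`) and degeneration to
additive reduction (`↦` Euler factor `1`) are degenerations; level LOWERING and the sign flip `1 − X ↦ 1 + X` at
a common multiplicative prime are not; the relation is reflexive and transitive (`dvd_rfl`, `dvd_trans`). -/

variable {W W' : WeierstrassCurve ℚ} {p : ℕ} {v : HeightOneSpectrum (𝓞 ℚ)}

/-- **desc-C9b (the local law): a degeneration can only LOWER `δ^{(v)}`.**  `δ = s_ℓ · d_ℓ` with `d_ℓ` the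
multiplicity of `ℓ̃⁻¹` as a root of `P̃_ℓ`; root multiplicities are monotone under divisibility of
polynomials (the larger one being nonzero).  Verbatim `HOME/desc/Sketch9.lean` §2.
[cite: GreenbergVatsal2000, §2 Prop. (2.4) (p. 22) — `δ_E^{(ℓ)} = s_ℓ d_ℓ`] -/
theorem delta_le_of_degeneration (h : eulerFactorModP W' p v ∣ eulerFactorModP W p v)
    (h0 : eulerFactorModP W p v ≠ 0) :
    delta W' p v ≤ delta W p v := by
  unfold GreenbergVatsal2000.delta dMultiplicity
  exact Nat.mul_le_mul_left _
    ((Polynomial.le_rootMultiplicity_iff h0).mpr ((Polynomial.pow_rootMultiplicity_dvd _ _).trans h))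

/-- The local law with the nonvanishing of `P̃_v(W)` discharged (`X2.EulerFactorInvariants.eulerFactorModP_ne_zero`:
constant term `1`), `p` prime. [cite: GreenbergVatsal2000, §2 Prop. (2.4) (p. 22)] -/
theorem delta_le_of_degeneration' [Fact p.Prime] (h : eulerFactorModP W' p v ∣ eulerFactorModP W p v) :
    delta W' p v ≤ delta W p v :=
  delta_le_of_degeneration h (eulerFactorModP_ne_zero W v)

end Local

/-! ## §2 The global direction law: `λ(X(W)) ≤ λ(X(W'))` along a degeneration (modulo GV's three statements) -/

section Global

variable {W W' : WeierstrassCurve ℚ} [W.IsElliptic] [W.IsGloballyMinimal] [W'.IsElliptic]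
  [W'.IsGloballyMinimal] {p : ℕ} [Fact p.Prime] {κ : ZpExtension ℚ p} {γ : absoluteGaloisGroup ℚ}

/-- **desc-C9 `DegenerationLambdaMonotone`, PROVED modulo Greenberg–Vatsal's three printed statements.**
`W, W'` globally minimal over `ℚ`, `p` odd, good ORDINARY for both, `W[p] ≃ W'[p]` (`TorsionIso`), `W'` a
degeneration of `W` at every finite place not above `p`; then for the cyclotomic `ℤ_p`-extension `κ`, any
topological generator `γ`, and all finitely generated `Λ`-torsion dual Selmer data `D` (for `W`) and `D'`
(for `W'`) with `μ = 0`: `λ(D.X) ≤ λ(D'.X)`.  Proof: `λ(D.X) + Σ_{Σ₀} δ_W = λ(D'.X) + Σ_{Σ₀} δ_{W'}` (the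
kernel form of GV p. 27 «`λ_{E₂,Σ₀} = λ_{E₁,Σ₀}`» with (7) substituted,
`X2.CongruentLambdaShiftDerived.lambda_add_sum_delta_eq_of_torsionIso`, for `Σ₀ :=` the bad places of
either curve not above `p`) and termwise `δ_{W'} ≤ δ_W` on `Σ₀` (`delta_le_of_degeneration`).  Conditional
on `hGV`, `hA`, `hB` (Literature named facts, by name); credits nothing.
[cite: GreenbergVatsal2000, Thm. (1.4), §2 (7), Prop. (2.4), (2.8) and pp. 26–27]
[cite: SilvermanAEC2009, VIII.1 Remark 1.3 (finiteness of the bad places)] -/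
theorem lambdaInvariant_le_of_eulerDegeneration (hGV : imKummer_ge_greenbergCondition_at_p)
    (hA : lambda_nonPrimitive_eq_add_sum_delta) (hB : divisible_nonPrimitiveSelmerInfty_of_mu_eq_zero)
    (hp2 : p ≠ 2) (hgood : W.HasGoodReductionAtPrime p) (hord : ¬ (p : ℤ) ∣ W.frobeniusTrace p)
    (hgood' : W'.HasGoodReductionAtPrime p) (hord' : ¬ (p : ℤ) ∣ W'.frobeniusTrace p)
    (hiso : TorsionIso W W' p)
    (hdeg : ∀ v : HeightOneSpectrum (𝓞 ℚ), Rat.HeightOneSpectrum.natGenerator v ≠ p →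
      eulerFactorModP W' p v ∣ eulerFactorModP W p v)
    (hκ : κ.IsCyclotomic) (hγ : κ.IsTopGenerator γ)
    (D : W.SelmerDualData κ γ) (D' : W'.SelmerDualData κ γ)
    [Module.Finite (IwasawaAlgebra p) D.X] [Module.Finite (IwasawaAlgebra p) D'.X]
    (hX : D.IsTorsion) (hX' : D'.IsTorsion) (hμ : D.mu = 0) (hμ' : D'.mu = 0) :
    lambdaInvariant p D.X ≤ lambdaInvariant p D'.X := by
  -- `Σ₀` := the bad places of `W` or of `W'` that do not lie above `p` (a finite set)
  have hfin : (W.badPlaces (𝓞 ℚ) ∪ W'.badPlaces (𝓞 ℚ)).Finite :=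
    (W.finite_badPlaces_holds (𝓞 ℚ)).union (W'.finite_badPlaces_holds (𝓞 ℚ))
  set S₀ : Finset (HeightOneSpectrum (𝓞 ℚ)) :=
    hfin.toFinset.filter (fun v => ((p : ℕ) : 𝓞 ℚ) ∉ v.asIdeal) with hS₀def
  have hS₀ : ∀ v ∈ S₀, ((p : ℕ) : 𝓞 ℚ) ∉ v.asIdeal := fun v hv =>
    (Finset.mem_filter.mp hv).2
  have hS₁ : ∀ v : HeightOneSpectrum (𝓞 ℚ), v ∉ S₀ → ((p : ℕ) : 𝓞 ℚ) ∉ v.asIdeal →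
      W.HasGoodReductionAt v := by
    intro v hv hpv
    by_contra hbad
    exact hv (Finset.mem_filter.mpr ⟨hfin.mem_toFinset.mpr (Or.inl hbad), hpv⟩)
  have hS₂ : ∀ v : HeightOneSpectrum (𝓞 ℚ), v ∉ S₀ → ((p : ℕ) : 𝓞 ℚ) ∉ v.asIdeal →
      W'.HasGoodReductionAt v := by
    intro v hv hpv
    by_contra hbad
    exact hv (Finset.mem_filter.mpr ⟨hfin.mem_toFinset.mpr (Or.inr hbad), hpv⟩)
  -- the kernel identity `λ(D.X) + Σ δ_W = λ(D'.X) + Σ δ_{W'}` over `Σ₀`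
  have heq := lambda_add_sum_delta_eq_of_torsionIso W W' S₀ hGV hA hB hp2 hgood hord hgood' hord'
    hκ hγ hS₀ hS₁ hS₂ hiso D D' hX hX' hμ hμ'
  -- termwise `δ_{W'} ≤ δ_W` on `Σ₀` (every `v ∈ Σ₀` is prime to `p`, so `hdeg` applies)
  have hsum : ∑ v ∈ S₀, delta W' p v ≤ ∑ v ∈ S₀, delta W p v :=
    Finset.sum_le_sum fun v hv =>
      delta_le_of_degeneration' (hdeg v (natGenerator_ne_of_natCast_not_mem v (hS₀ v hv)))
  omega

/-- **The trivial-value reading**: if a congruent DEGENERATION `W'` of `W` has `λ(X(W')) = 0` (at `μ = 0`),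
then already `λ(X(W)) = 0` — a `λ = 0` partner can certify nothing new UP the degeneration poset.
[cite: GreenbergVatsal2000, Thm. (1.4), §2 (7), Prop. (2.8) and pp. 26–27] -/
theorem lambdaInvariant_eq_zero_of_eulerDegeneration (hGV : imKummer_ge_greenbergCondition_at_p)
    (hA : lambda_nonPrimitive_eq_add_sum_delta) (hB : divisible_nonPrimitiveSelmerInfty_of_mu_eq_zero)
    (hp2 : p ≠ 2) (hgood : W.HasGoodReductionAtPrime p) (hord : ¬ (p : ℤ) ∣ W.frobeniusTrace p)
    (hgood' : W'.HasGoodReductionAtPrime p) (hord' : ¬ (p : ℤ) ∣ W'.frobeniusTrace p)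
    (hiso : TorsionIso W W' p)
    (hdeg : ∀ v : HeightOneSpectrum (𝓞 ℚ), Rat.HeightOneSpectrum.natGenerator v ≠ p →
      eulerFactorModP W' p v ∣ eulerFactorModP W p v)
    (hκ : κ.IsCyclotomic) (hγ : κ.IsTopGenerator γ)
    (D : W.SelmerDualData κ γ) (D' : W'.SelmerDualData κ γ)
    [Module.Finite (IwasawaAlgebra p) D.X] [Module.Finite (IwasawaAlgebra p) D'.X]
    (hX : D.IsTorsion) (hX' : D'.IsTorsion) (hμ : D.mu = 0) (hμ' : D'.mu = 0)
    (hl' : lambdaInvariant p D'.X = 0) : lambdaInvariant p D.X = 0 :=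
  Nat.eq_zero_of_le_zero (hl' ▸ lambdaInvariant_le_of_eulerDegeneration hGV hA hB hp2 hgood hord hgood'
    hord' hiso hdeg hκ hγ D D' hX hX' hμ hμ')

/-- **The direction law read as a NO-GO (MEMO-desc §15.0 (A)): a pair with `λ(X(W)) ≥ 1` has NO congruent
good-ordinary degeneration `W'` with `λ(X(W')) = 0`** (at `μ = 0`; modulo GV's three statements) —
`μ`-certification by a trivial-value partner flows only DOWN the degeneration poset of `H(ρ̄)`.
[cite: GreenbergVatsal2000, Thm. (1.4), §2 (7), Prop. (2.8) and pp. 26–27] -/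
theorem not_eulerDegeneration_of_lambda_pos (hGV : imKummer_ge_greenbergCondition_at_p)
    (hA : lambda_nonPrimitive_eq_add_sum_delta) (hB : divisible_nonPrimitiveSelmerInfty_of_mu_eq_zero)
    (hp2 : p ≠ 2) (hgood : W.HasGoodReductionAtPrime p) (hord : ¬ (p : ℤ) ∣ W.frobeniusTrace p)
    (hgood' : W'.HasGoodReductionAtPrime p) (hord' : ¬ (p : ℤ) ∣ W'.frobeniusTrace p)
    (hiso : TorsionIso W W' p) (hκ : κ.IsCyclotomic) (hγ : κ.IsTopGenerator γ)
    (D : W.SelmerDualData κ γ) (D' : W'.SelmerDualData κ γ)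
    [Module.Finite (IwasawaAlgebra p) D.X] [Module.Finite (IwasawaAlgebra p) D'.X]
    (hX : D.IsTorsion) (hX' : D'.IsTorsion) (hμ : D.mu = 0) (hμ' : D'.mu = 0)
    (hl : 1 ≤ lambdaInvariant p D.X) (hl' : lambdaInvariant p D'.X = 0) :
    ¬ ∀ v : HeightOneSpectrum (𝓞 ℚ), Rat.HeightOneSpectrum.natGenerator v ≠ p →
      eulerFactorModP W' p v ∣ eulerFactorModP W p v := by
  intro hdeg
  have h0 := lambdaInvariant_eq_zero_of_eulerDegeneration hGV hA hB hp2 hgood hord hgood' hord' hiso hdeg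
    hκ hγ D D' hX hX' hμ hμ' hl'
  omega

/-- **The candidate's registered shape, verbatim** (`HOME/desc/Sketch9.lean` §3 `Desc7.DegenerationLambdaMonotone`,
whose binder list also carries `W[p]` irreducible and `IsCyclotomicVariable p γ`, both unused by the
proof): modulo `hGV`, `hA`, `hB` the Prop holds as stated.  (So desc-C9 is a THEOREM modulo three printed
statements, not an open node; refuter re-probe: `example (hGV) (hA) (hB) : Desc7.DegenerationLambdaMonotone :=
degenerationLambdaMonotone_of_greenbergVatsal hGV hA hB`.)
[cite: GreenbergVatsal2000, Thm. (1.4), §2 (7), Prop. (2.4), (2.8) and pp. 26–27] -/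
theorem degenerationLambdaMonotone_of_greenbergVatsal (hGV : imKummer_ge_greenbergCondition_at_p)
    (hA : lambda_nonPrimitive_eq_add_sum_delta) (hB : divisible_nonPrimitiveSelmerInfty_of_mu_eq_zero) :
    ∀ (W W' : WeierstrassCurve ℚ) [W.IsElliptic] [W.IsGloballyMinimal] [W'.IsElliptic]
      [W'.IsGloballyMinimal] (p : ℕ) [Fact p.Prime], p ≠ 2 →
      W.HasGoodReductionAtPrime p → ¬ (p : ℤ) ∣ W.frobeniusTrace p →
      W'.HasGoodReductionAtPrime p → ¬ (p : ℤ) ∣ W'.frobeniusTrace p →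
      W.HasIrreducibleModPGaloisRep p → TorsionIso W W' p →
      (∀ v : HeightOneSpectrum (𝓞 ℚ), Rat.HeightOneSpectrum.natGenerator v ≠ p →
        eulerFactorModP W' p v ∣ eulerFactorModP W p v) →
      ∀ (κ : ZpExtension ℚ p) (γ : Field.absoluteGaloisGroup ℚ),
        κ.IsCyclotomic → κ.IsTopGenerator γ → IsCyclotomicVariable p γ →
      ∀ (D : W.SelmerDualData κ γ) (D' : W'.SelmerDualData κ γ)
        [Module.Finite (IwasawaAlgebra p) D.X] [Module.Finite (IwasawaAlgebra p) D'.X],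
        D.IsTorsion → D'.IsTorsion → D.mu = 0 → D'.mu = 0 →
        lambdaInvariant p D.X ≤ lambdaInvariant p D'.X :=
  fun _W _W' _ _ _ _ _p _ hp2 hgood hord hgood' hord' _hirr hiso hdeg _κ _γ hκ hγ _ D D' _ _ hX hX' hμ hμ' =>
    lambdaInvariant_le_of_eulerDegeneration hGV hA hB hp2 hgood hord hgood' hord' hiso hdeg hκ hγ D D'
      hX hX' hμ hμ'

end Global

end Summit.BirchSwinnertonDyer.Rank1Residual.SmallImageMu

end
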